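import Summits.ABC.IUTFork.LDHGenuineHullRegimeSlack
import HarnessLib

/-!
# The fork at [IUTchIII] Corollary 3.12, L-DH level, READING (U): the (Ind1) slot residue is absorbed by the FULL slack
# of print's constant `B_III(P, l)` — the Step (viii) prime-count slack AND the Step (iii) conductor share
# `((l+1)/4)·(4(d_mod − 1)/l)·(log-diff + log-cond)` — so at fixed `l` the (U)-hull estimate FOLLOWS from a SZPIRO-TYPE
# inequality on the point (abc-iut cell, R2 S-chain team seat abc-iut-s2-p1; crux ThetaPartII = stmt-ABC-19678,
# registered stubs `stub_hullVolume` / `stub_hullRegime`; the CONE binder `hvol` of `Conditional/AbcOfSGenuine.lean` v3)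

Record-only PROOF file (D-0012) of the abc-iut cell; TAKES NO SIDE on [IUTchIII] Cor. 3.12 or on the (U)/(P) readings of
"−|log(Θ)|". Mochizuki, *Inter-universal Teichmüller theory IV* (RIMS manuscript Apr. 2020 = PRIMS **57** (2021)), Thm. 1.10
proof Step (ii) p. 24 (the printed line `log(𝔡^K) ≤ log(𝔡^{F_tpd}) + log(𝔣^{F_tpd}) + 2·log(l) + 21`), Step (iii) p. 26
("the estimate `d_mod ≥ 1`": the step `4/l ≤ 4·d_mod/l`), Step (v) pp. 27–29, Step (viii) p. 30 (`log(𝔰^≤)` via the prime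
number theorem); Dupuy–Hilado [DupuyHilado2025] §4.7, §4.11–4.12 ((Ind1) = permutations of the tensor factors, hull).

THE OBSERVATION (sequel to abc-iut-c312-d1's `LDHGenuineHullRegimeSlack`). The kernel has, for EVERY genuine Θ-volume input and
NO slot-constancy, `HullEstimateOf (δ_explicit + slotResidue)` (c312-d1 `DHData.hullEstimateOf_ofInput_min_explicit`), with
`δ_explicit = (l+1)/4·{(1+4/l)·A + (4/l)·B + (20/3)·log(d*·l)·#{p ∈ T(I) : p ≤ d*·l}}`, `A ≤ log-diff + log-cond + 2 log l + 21`
(abc-iut-S1/S-d1, Step (ii)), `B ≤ 2·d_mod·(log-diff + log-cond) + log(30·l)` (abc-iut-S3, Step (iii)). Print's tower arithmetic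
(`Cor22.stepiii_final_of_le21`) turns this into `B_III(P,l) = (l+1)/4·{(1 + 12·d_mod/l)·(log-diff + log-cond) + 2 log l + 52 +
(20/3)·log(d*·l)·π(d*·l)}` using, among others, the step `(4/l)·L ≤ (4·d_mod/l)·L` — which at `d_mod ≥ 2` leaves the share
`((l+1)/4)·(4(d_mod−1)/l)·(log-diff + log-cond)` of `B_III` UNUSED. Keeping that share (`stepiii_final_of_le21_slack`):

* `PointDict.hullEstimateOf_BIII_of_slotResidue_le_szpiroSlack` — `T.HullEstimateOf (B_III P l)` whenever
  `slotResidue(T) ≤ (l+1)/4·{(4(d_mod−1)/l)·(log-diff + log-cond) + (20/3)·log(d*·l)·(π(d*·l) − #{p ∈ T(I) : p ≤ d*·l})}`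
  (c312-d1's slack lemma is the case where the first summand is dropped);
* `PointDict.hullEstimateOf_BIII_of_logQAvoid_le_szpiro` / `hullVolumeAtDatum_BIII_of_logQAvoid_le_szpiro` — the DATUM-FREE
  antecedent: since `slotResidue(T) ≤ ((l+1)/24)·log(q^{∤{2,l}}(λ))` (c312-d1) and `#T(I)·log 2 ≤ 2·d_mod·(log-diff + log-cond) +
  log(30·l)` (abc-iut-S3), the (U)-hull estimate with print's `B_III` holds at EVERY datum of every `(P, l)` (`λ ∈ U_P` minimal,
  `l ≥ 7`) satisfying the SZPIRO-TYPE inequality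
  `log(q^{∤{2,l}}(λ)) ≤ (24(d_mod−1)/l)·(log-diff + log-cond) + 40·log(d*·l)·(π(d*·l) − (2·d_mod·(log-diff + log-cond) + log(30·l))/log 2)`;
* `PointDict.hullVolumeAtDatum_BIII_of_logQAvoid_le_szpiro'` — the same with the weaker but sign-definite count bound
  `#{p ∈ T(I) : p ≤ d*l} ≤ π(d*l)`: `log(q^{∤{2,l}}(λ)) ≤ (24(d_mod−1)/l)·(log-diff + log-cond)` suffices — a PURE Szpiro-type
  inequality (no additive constant), e.g. `log q ≤ (24/7)·(log-diff + log-cond)` at `l = 7`, `d_mod = 2`.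

READING (for the planners; nothing asserted about print). Together with the NECESSITY direction (abc-iut-S8
`PointDict.slotResidue_le_of_hullVolumeAtDatum`, abc-iut-S7 `PointDict.ordPair_le_of_hullVolumeAtDatum`: `hvol` at `(P,l)` forces
`Pr(v)·Pr(w)·((l+1)/24)·(local height of j(λ) at a split bad place v) ≤ B_III(P,l)`, coefficient `6·(1+12·d_mod/l)/(Pr(v)Pr(w))` on
`log-diff + log-cond` after normalisation), this SANDWICHES the CONE binder `hvol(·, l)` of `abc_of_S_v3` at each fixed level `l`
between two explicit abc/Szpiro-type inequalities for the point `λ` (sufficient coefficient `24(d_mod−1)/l`, necessary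
coefficient `6(1+12d_mod/l)/(Pr·Pr)`, additive constants `≈ 40·d*·l·log(d*l)`): at `d_mod ≥ 2` the (U)-reading residual is OF
SZPIRO TYPE IN BOTH DIRECTIONS — neither a volume computation (which would prove an effective Szpiro bound) nor an in-cell
refutation (which would exhibit a Szpiro-violating admissible `λ`) can settle it. At `d_mod = 1` the sufficient inequality
degenerates (coefficient `0`) but there the residue vanishes and `hvol` is a theorem (abc-iut-S3
`hullVolumeAtDatum_BIII_pinned_of_dmod_eq_one`). HONEST SCOPE: arithmetic on the cell's own typed constants; no datum is
constructed; no side taken on Cor. 3.12 / Thm. 1.10; typed ≠ proved. PROOF-ONLY file: no definitions, no named `Prop` facts.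
[cite: Mochizuki2012, IUTchIV Thm. 1.10 proof Steps (ii)–(viii) p. 24–30] [cite: DupuyHilado2025, §4.7, §4.11–4.12]
[claim: Mochizuki2012, status: disputed] for every IUT quotation.
-/

noncomputable section

namespace Summit.ABC.IUTFork

open Literature.IUT.HodgeTheaters Literature.IUT.LogVolume NumberField IsDedekindDomain
open Literature.NumberTheory.DiophantineGeometry.GenEll
open scoped Nat.Prime

namespace PointDict

variable {P : NFPoint} {l : ℕ}

/-! ## Print's Steps (ii)–(iii) tower arithmetic WITH the conductor share kept -/

/-- **Steps (ii)–(iii) assembled from the printed `+ 21` line, conductor share KEPT**: for reals `l ≥ 5`, `d ≥ 1`,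
`L = log(𝔡^{F_tpd}) + log(𝔣^{F_tpd})`, `log(𝔡^K) ≤ L + 2·log(l) + 21`, `log(𝔰^ℚ) ≤ 2·d·L + log(2·3·5·l)`:
`(1 + 4/l)·log(𝔡^K) + (4/l)·log(𝔰^ℚ) + (4(d−1)/l)·L ≤ (1 + 12·d/l)·L + 2·log(l) + 52` — print's own derivation (p. 24 "`log(l)/l ≤
1/2`, `1 + 4/l ≤ 2`"; p. 26 "the estimate `d_mod ≥ 1`"), i.e. abc-iut-S3's `Cor22.stepiii_final_of_le21` with the share that the
step `4/l ≤ 4·d/l` discards made explicit (so that neither `d ≥ 1` nor `L ≥ 0` is needed any more). [cite: Mochizuki2012, IUTchIV Thm. 1.10 proof Step (ii) p. 24, Step (iii) p. 26]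
[claim: Mochizuki2012, status: disputed] -/
theorem stepiii_final_of_le21_slack {l d L dK sQ : ℝ} (hl : 5 ≤ l)
    (hK : dK ≤ L + 2 * Real.log l + 21) (hsQ : sQ ≤ 2 * d * L + Real.log (2 * 3 * 5 * l)) :
    (1 + 4 / l) * dK + 4 / l * sQ + 4 * (d - 1) / l * L ≤ (1 + 12 * d / l) * L + 2 * Real.log l + 52 := by
  have hl0 : (0 : ℝ) < l := by linarith
  have hlog0 : 0 ≤ Real.log l := Real.log_nonneg (by linarith)
  have hll : Real.log l / l ≤ 1 / 2 := log_div_self_le_half hl0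
  have h30 : Real.log (2 * 3 * 5 * l) ≤ 5 + Real.log l := log_thirty_mul_le hl0
  have hc : 0 ≤ 1 + 4 / l := by positivity
  have h4l : 4 / l ≤ 1 := by rw [div_le_one hl0]; linarith
  -- Step (ii), final display: `(1 + 4/l)·log(𝔡^K) ≤ (1 + 4/l)·L + 2·log(l) + 46`
  have h1 := mul_le_mul_of_nonneg_left hK hc
  have h8 : 4 / l * (2 * Real.log l) ≤ 4 := by
    have : 4 / l * (2 * Real.log l) = 8 * (Real.log l / l) := by ring
    rw [this]; linarith
  have e1 : (1 + 4 / l) * (L + 2 * Real.log l + 21) =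
      (1 + 4 / l) * L + 2 * Real.log l + 4 / l * (2 * Real.log l) + (1 + 4 / l) * 21 := by ring
  rw [e1] at h1
  have h42 : (1 + 4 / l) * 21 ≤ 42 := by nlinarith
  -- Step (iii): `(4/l)·log(𝔰^ℚ) ≤ (8·d/l)·L + 6`
  have hc' : 0 ≤ 4 / l := by positivity
  have h2 := mul_le_mul_of_nonneg_left (hsQ.trans (by linarith : 2 * d * L + Real.log (2 * 3 * 5 * l) ≤
    2 * d * L + 5 + Real.log l)) hc'
  have e2 : 4 / l * (2 * d * L + 5 + Real.log l) = 8 * d / l * L + 20 / l + 4 * (Real.log l / l) := by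
    field_simp; ring
  rw [e2] at h2
  have h20 : 20 / l ≤ 4 := by rw [div_le_iff₀ hl0]; linarith
  -- combine, keeping `(4(d−1)/l)·L = (4d/l)·L − (4/l)·L`
  have e3 : (1 + 4 / l) * L = L + 4 / l * L := by ring
  have e4 : (1 + 12 * d / l) * L = L + 4 * d / l * L + 8 * d / l * L := by ring
  have e5 : 4 * (d - 1) / l * L = 4 * d / l * L - 4 / l * L := by ring
  rw [e3] at h1; rw [e4, e5]
  linarith

/-- **`δ_K + ((l+1)/4)·(4(d_mod−1)/l)·(log-diff + log-cond) ≤ B_III(P, l)`** — abc-iut-S3's `Cor22.deltaK_le_BIII_of_le21` (the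
number-free half of S-b from print's `+ 21` line, with `sLe = π(d*·l)` and `e_mod := d_mod`) with the conductor share kept.
[cite: Mochizuki2012, IUTchIV Thm. 1.10 proof Step (ii) p. 24, Step (iii) p. 26, Step (v) p. 29] [claim: Mochizuki2012, status: disputed] -/
theorem deltaK_add_condShare_le_BIII (h5 : 5 ≤ l) {dK sQ : ℝ}
    (hK : dK ≤ P.logDiff + Cor22.logCondAvoid P {2, l} + 2 * Real.log l + 21)
    (hsQle : sQ ≤ 2 * (Cor22.dmod P : ℝ) * (P.logDiff + Cor22.logCondAvoid P {2, l}) + Real.log (2 * 3 * 5 * (l : ℝ))) :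
    ((l : ℝ) + 1) / 4 * ((1 + 4 / (l : ℝ)) * dK + 4 / (l : ℝ) * sQ
        + 20 / 3 * Real.log ((2 : ℝ) ^ 12 * 3 ^ 3 * 5 * (Cor22.dmod P) * l)
          * (Nat.primeCounting (2 ^ 12 * 3 ^ 3 * 5 * Cor22.dmod P * l) : ℝ))
      + ((l : ℝ) + 1) / 4 * (4 * ((Cor22.dmod P : ℝ) - 1) / l * (P.logDiff + Cor22.logCondAvoid P {2, l})) ≤
      ((l : ℝ) + 1) / 4 * ((1 + 12 * (Cor22.dmod P : ℝ) / l) * (P.logDiff + Cor22.logCondAvoid P {2, l}) + 2 * Real.log l + 52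
        + 20 / 3 * Real.log (((2 ^ 12 * 3 ^ 3 * 5 * Cor22.dmod P : ℕ) : ℝ) * (l : ℝ))
          * (Nat.primeCounting (2 ^ 12 * 3 ^ 3 * 5 * Cor22.dmod P * l) : ℝ)) := by
  have hl5 : (5 : ℝ) ≤ l := by exact_mod_cast h5
  have h1 := stepiii_final_of_le21_slack (d := (Cor22.dmod P : ℝ)) hl5 hK hsQle
  have hl0 : (0 : ℝ) ≤ ((l : ℝ) + 1) / 4 := by positivity
  have e : ((2 : ℝ) ^ 12 * 3 ^ 3 * 5 * (Cor22.dmod P) * l) = (((2 ^ 12 * 3 ^ 3 * 5 * Cor22.dmod P : ℕ) : ℝ) * (l : ℝ)) := by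
    push_cast; ring
  rw [e]
  have h3 : (1 + 4 / (l : ℝ)) * dK + 4 / (l : ℝ) * sQ
      + 20 / 3 * Real.log (((2 ^ 12 * 3 ^ 3 * 5 * Cor22.dmod P : ℕ) : ℝ) * (l : ℝ))
          * (Nat.primeCounting (2 ^ 12 * 3 ^ 3 * 5 * Cor22.dmod P * l) : ℝ)
      + 4 * ((Cor22.dmod P : ℝ) - 1) / l * (P.logDiff + Cor22.logCondAvoid P {2, l}) ≤
      (1 + 12 * (Cor22.dmod P : ℝ) / l) * (P.logDiff + Cor22.logCondAvoid P {2, l}) + 2 * Real.log l + 52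
        + 20 / 3 * Real.log (((2 ^ 12 * 3 ^ 3 * 5 * Cor22.dmod P : ℕ) : ℝ) * (l : ℝ))
          * (Nat.primeCounting (2 ^ 12 * 3 ^ 3 * 5 * Cor22.dmod P * l) : ℝ) := by
    linarith
  have := mul_le_mul_of_nonneg_left h3 hl0
  linarith

/-- `log((2^12·3^3·5·d)·l) ≥ 0` for `d, l ≥ 1`. [cite: Mochizuki2012, IUTchIV Thm. 1.10 p. 22] -/
private theorem log_dstar_mul_nonneg₄ {d l : ℕ} (hd : 1 ≤ d) (hl : 1 ≤ l) :
    0 ≤ Real.log (((2 ^ 12 * 3 ^ 3 * 5 * d : ℕ) : ℝ) * l) := by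
  apply Real.log_nonneg
  have h1 : (1 : ℝ) ≤ ((2 ^ 12 * 3 ^ 3 * 5 * d : ℕ) : ℝ) := by exact_mod_cast (by nlinarith : 1 ≤ 2 ^ 12 * 3 ^ 3 * 5 * d)
  have h2 : (1 : ℝ) ≤ (l : ℝ) := by exact_mod_cast hl
  nlinarith

/-! ## The (U)-hull estimate from «slot residue ≤ FULL slack of `B_III`» -/

/-- **READING (U), NO SLOT-CONSTANCY: `T.HullEstimateOf (B_III P l)` whenever the slot residue fits into the FULL slack of
`B_III`** — for `λ ∈ U_P` (minimally presented), `l ≥ 7` and a genuine Θ-volume datum `T` at `(P, l)`: if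
`slotResidue(T) ≤ (l+1)/4·{(4(d_mod−1)/l)·(log-diff + log-cond) + (20/3)·log(d*·l)·(π(d*·l) − #{p ∈ T(I) : p ≤ d*·l})}` then
`T.HullEstimateOf (B_III P l)` (exact registered bytes of `B_III`). Composition: abc-iut-c312-d1
`DHData.hullEstimateOf_ofInput_min_explicit` (`HullEstimateOf (δ_explicit + slotResidue)`, every input, the `λ_min` form of
[IUTchIV] Step (v)) at `N := d*·l`, `l* := log(d*·l)`, with abc-iut-S1's (R4) `Cor22.ThetaVolumeDatumAt.R4_towerFact`, the Step
(ii)/(iii) bounds of abc-iut-S1/S-d1/S3 (`sum_dite_localDegree_mul_differentOrd_le_ndeg`, `ndeg_differentDivisor_le`,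
`sum_log_supportPrimes_le_pinned`), and `deltaK_add_condShare_le_BIII`. Strengthens c312-d1's
`hullEstimateOf_BIII_of_slotResidue_le_slack` (the case where the conductor share is dropped).
[cite: Mochizuki2012, IUTchIV Thm. 1.10 proof Steps (ii)–(viii) p. 24–30] [claim: Mochizuki2012, status: disputed] -/
theorem hullEstimateOf_BIII_of_slotResidue_le_szpiroSlack (T : Cor22.ThetaVolumeDatumAt P l) (hP : P ∈ UP) (h7 : 7 ≤ l)
    (hres : letI := T.instFieldF; letI := T.instNumberFieldF; letI := T.instFieldK; letI := T.instNumberFieldK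
      letI := T.instAlgebraK
      T.I.X.slotResidue T.I.supportPrimes ≤
        ((l : ℝ) + 1) / 4 * (4 * ((Cor22.dmod P : ℝ) - 1) / l * (P.logDiff + Cor22.logCondAvoid P {2, l})
          + 20 / 3 * Real.log (((2 ^ 12 * 3 ^ 3 * 5 * Cor22.dmod P : ℕ) : ℝ) * l)
            * ((Nat.primeCounting (2 ^ 12 * 3 ^ 3 * 5 * Cor22.dmod P * l) : ℝ)
              - ((T.I.supportPrimes.filter (· ≤ 2 ^ 12 * 3 ^ 3 * 5 * Cor22.dmod P * l)).card : ℝ)))) :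
    T.HullEstimateOf (((l : ℝ) + 1) / 4 * ((1 + 12 * (Cor22.dmod P : ℝ) / l) * (P.logDiff + Cor22.logCondAvoid P {2, l})
      + 2 * Real.log l + 52 + 20 / 3 * Real.log (((2 ^ 12 * 3 ^ 3 * 5 * Cor22.dmod P : ℕ) : ℝ) * (l : ℝ))
        * (Nat.primeCounting (2 ^ 12 * 3 ^ 3 * 5 * Cor22.dmod P * l) : ℝ))) := by
  classical
  letI := T.instFieldF; letI := T.instNumberFieldF; letI := T.instAlgebraF; letI := T.instFieldK
  letI := T.instNumberFieldK; letI := T.instAlgebraK; letI := T.instFieldFbar; letI := T.instAlgebraFbar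
  letI := T.instAlgebraKFbar; letI := T.instIsElliptic
  have hU : P.InU := hP.1
  have h5 : 5 ≤ l := by omega
  have hl1 : 1 ≤ l := by omega
  have hd : 1 ≤ Cor22.dmod P := Cor22.dmod_pos P
  have hXl : ((T.I.X.l : ℕ) : ℝ) = (l : ℝ) := by exact_mod_cast T.isVolumeInputOf.l_eq
  haveI : IsGalois (fieldOfModuli T.E) T.K := T.isGalois_fieldOfModuli_K
  have hprimes : ∀ p ∈ T.I.supportPrimes, p.Prime := fun p hp => T.I.prime_of_mem_supportPrimes hp
  have hlmod := log_dstar_mul_nonneg₄ hd hl1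
  -- S-a in the `λ_min` form: `HullEstimateOf (δ_explicit + slotResidue)`, every datum, (R4) by abc-iut-S1
  have h0 := DHData.hullEstimateOf_ofInput_min_explicit T.I (2 ^ 12 * 3 ^ 3 * 5 * Cor22.dmod P * l) hlmod
    (T.R4_towerFact hP)
  rw [hXl] at h0
  -- `A ≤ log 𝔡^K ≤ log-diff + log 𝔣 + 2·log l + 21`
  have hA1 := sum_dite_localDegree_mul_differentOrd_le_ndeg (fieldOfModuli T.E) T.K T.I.σ T.I.supportPrimes hprimes
  have hA2 := T.ndeg_differentDivisor_le hU h7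
  have hA : (∑ p ∈ T.I.supportPrimes, if hp : p.Prime then haveI : Fact p.Prime := ⟨hp⟩
        (∑ v : placesOver (fieldOfModuli T.E) p, (localDegree (fieldOfModuli T.E) v.1 : ℝ) *
          differentOrd p ((T.I.σ.localFieldFamily p hp).k v)) / Module.finrank ℚ (fieldOfModuli T.E) * Real.log p
        else 0) ≤ P.logDiff + Cor22.logCondAvoid P {2, l} + 2 * Real.log l + 21 := hA1.trans hA2
  -- `B ≤ 2·d_mod·(log-diff + log 𝔣) + log(30·l)`
  have hB := T.sum_log_supportPrimes_le_pinned hP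
  -- tower arithmetic with the conductor share kept
  have hδ := deltaK_add_condShare_le_BIII (P := P) h5 hA hB
  have e : (((2 ^ 12 * 3 ^ 3 * 5 * Cor22.dmod P : ℕ) : ℝ) * l) = ((2 : ℝ) ^ 12 * 3 ^ 3 * 5 * (Cor22.dmod P) * l) := by
    push_cast; ring
  rw [e] at hres h0
  refine T.hullEstimateOf_mono h0 ?_
  have hc0 : (0 : ℝ) ≤ ((l : ℝ) + 1) / 4 := by positivity
  -- `δ_explicit(count) + slotResidue ≤ δ_explicit(count) + condShare + slack_π = δ_explicit(π) + condShare ≤ B_III`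
  nlinarith [hδ, hres, hc0]

/-! ## The DATUM-FREE Szpiro-type antecedent -/

/-- **READING (U), NO SLOT-CONSTANCY, UNDER A SZPIRO-TYPE INEQUALITY ON THE POINT: `T.HullEstimateOf (B_III P l)`** for
`λ ∈ U_P` (minimally presented), `l ≥ 7`, every genuine Θ-volume datum `T` at `(P, l)`, PROVIDED
`log(q^{∤{2,l}}(λ)) ≤ (24(d_mod−1)/l)·(log-diff + log-cond) + 40·log(d*·l)·(π(d*·l) − (2·d_mod·(log-diff + log-cond) + log(30·l))/log 2)`
— the slot residue (`≤ ((l+1)/24)·log q`, c312-d1 `slotResidue_le_logQAvoid`) then fits into the full slack (count bound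
abc-iut-S3 / c312-d1 `card_supportPrimes_filter_le`). The antecedent mentions no Θ-datum and no IUT object: it is an
abc/Szpiro-type inequality for `λ` with conductor coefficient `24(d_mod−1)/l` and an explicit additive constant.
[cite: Mochizuki2012, IUTchIV Thm. 1.10 proof Steps (ii)–(viii) p. 24–30] [claim: Mochizuki2012, status: disputed] -/
theorem hullEstimateOf_BIII_of_logQAvoid_le_szpiro (T : Cor22.ThetaVolumeDatumAt P l) (hP : P ∈ UP) (h7 : 7 ≤ l)
    (h : Cor22.logQAvoid P {2, l} ≤
      24 * ((Cor22.dmod P : ℝ) - 1) / l * (P.logDiff + Cor22.logCondAvoid P {2, l})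
      + 40 * Real.log (((2 ^ 12 * 3 ^ 3 * 5 * Cor22.dmod P : ℕ) : ℝ) * l)
        * ((Nat.primeCounting (2 ^ 12 * 3 ^ 3 * 5 * Cor22.dmod P * l) : ℝ)
          - (2 * (Cor22.dmod P : ℝ) * (P.logDiff + Cor22.logCondAvoid P {2, l}) + Real.log (2 * 3 * 5 * (l : ℝ)))
            / Real.log 2)) :
    T.HullEstimateOf (((l : ℝ) + 1) / 4 * ((1 + 12 * (Cor22.dmod P : ℝ) / l) * (P.logDiff + Cor22.logCondAvoid P {2, l})
      + 2 * Real.log l + 52 + 20 / 3 * Real.log (((2 ^ 12 * 3 ^ 3 * 5 * Cor22.dmod P : ℕ) : ℝ) * (l : ℝ))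
        * (Nat.primeCounting (2 ^ 12 * 3 ^ 3 * 5 * Cor22.dmod P * l) : ℝ))) := by
  letI := T.instFieldF; letI := T.instNumberFieldF; letI := T.instAlgebraF; letI := T.instFieldK
  letI := T.instNumberFieldK; letI := T.instAlgebraK; letI := T.instIsElliptic
  have hl1 : 1 ≤ l := by omega
  have hd : 1 ≤ Cor22.dmod P := Cor22.dmod_pos P
  have hlmod := log_dstar_mul_nonneg₄ hd hl1
  refine hullEstimateOf_BIII_of_slotResidue_le_szpiroSlack T hP h7 ?_
  have hres := slotResidue_le_logQAvoid T
  have hcnt := card_supportPrimes_filter_le T hP (2 ^ 12 * 3 ^ 3 * 5 * Cor22.dmod P * l)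
  have hl0 : (0 : ℝ) ≤ ((l : ℝ) + 1) / 24 := by positivity
  have hlpos : (0 : ℝ) < l := by exact_mod_cast (show 0 < l by omega)
  -- `slotResidue ≤ ((l+1)/24)·log q ≤ ((l+1)/24)·(24(d−1)/l·L + 40·ℓ·(π − bound/log 2)) ≤ (l+1)/4·(4(d−1)/l·L + (20/3)·ℓ·(π − count))`
  have h1 := mul_le_mul_of_nonneg_left h hl0
  have h2 : Real.log (((2 ^ 12 * 3 ^ 3 * 5 * Cor22.dmod P : ℕ) : ℝ) * l) *
      ((Nat.primeCounting (2 ^ 12 * 3 ^ 3 * 5 * Cor22.dmod P * l) : ℝ)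
        - (2 * (Cor22.dmod P : ℝ) * (P.logDiff + Cor22.logCondAvoid P {2, l}) + Real.log (2 * 3 * 5 * (l : ℝ)))
          / Real.log 2) ≤
      Real.log (((2 ^ 12 * 3 ^ 3 * 5 * Cor22.dmod P : ℕ) : ℝ) * l) *
        ((Nat.primeCounting (2 ^ 12 * 3 ^ 3 * 5 * Cor22.dmod P * l) : ℝ)
          - ((T.I.supportPrimes.filter (· ≤ 2 ^ 12 * 3 ^ 3 * 5 * Cor22.dmod P * l)).card : ℝ)) :=
    mul_le_mul_of_nonneg_left (by linarith) hlmod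
  have e1 : ((l : ℝ) + 1) / 24 * (24 * ((Cor22.dmod P : ℝ) - 1) / l * (P.logDiff + Cor22.logCondAvoid P {2, l})) =
      ((l : ℝ) + 1) / 4 * (4 * ((Cor22.dmod P : ℝ) - 1) / l * (P.logDiff + Cor22.logCondAvoid P {2, l})) := by ring
  nlinarith [hres, h1, h2, hl0, e1]

/-- **The `∀ T` form: `Cor22.HullVolumeAtDatum P l (B_III P l)` in READING (U), NO slot-constancy, at every `(P, l)` with
`λ ∈ U_P` (minimally presented), `l ≥ 7`, satisfying the Szpiro-type inequality
`log(q^{∤{2,l}}(λ)) ≤ (24(d_mod−1)/l)·(log-diff + log-cond) + 40·log(d*·l)·(π(d*·l) − (2·d_mod·(log-diff + log-cond) + log(30·l))/log 2)`**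
— i.e. the body of the (U)-line's volume edge (ii′) / the CONE binder `hvol` of `abc_of_S_v3` at `(P, l)` FOLLOWS from an
abc-type inequality on the point with conductor coefficient `24(d_mod−1)/l`. DATUM-FREE, IUT-free antecedent.
[cite: Mochizuki2012, IUTchIV Thm. 1.10 proof Steps (ii)–(viii) p. 24–30] [claim: Mochizuki2012, status: disputed] -/
theorem hullVolumeAtDatum_BIII_of_logQAvoid_le_szpiro (hP : P ∈ UP) (h7 : 7 ≤ l)
    (h : Cor22.logQAvoid P {2, l} ≤
      24 * ((Cor22.dmod P : ℝ) - 1) / l * (P.logDiff + Cor22.logCondAvoid P {2, l})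
      + 40 * Real.log (((2 ^ 12 * 3 ^ 3 * 5 * Cor22.dmod P : ℕ) : ℝ) * l)
        * ((Nat.primeCounting (2 ^ 12 * 3 ^ 3 * 5 * Cor22.dmod P * l) : ℝ)
          - (2 * (Cor22.dmod P : ℝ) * (P.logDiff + Cor22.logCondAvoid P {2, l}) + Real.log (2 * 3 * 5 * (l : ℝ)))
            / Real.log 2)) :
    Cor22.HullVolumeAtDatum P l (((l : ℝ) + 1) / 4 * ((1 + 12 * (Cor22.dmod P : ℝ) / l)
      * (P.logDiff + Cor22.logCondAvoid P {2, l}) + 2 * Real.log l + 52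
        + 20 / 3 * Real.log (((2 ^ 12 * 3 ^ 3 * 5 * Cor22.dmod P : ℕ) : ℝ) * (l : ℝ))
          * (Nat.primeCounting (2 ^ 12 * 3 ^ 3 * 5 * Cor22.dmod P * l) : ℝ))) :=
  fun T => hullEstimateOf_BIII_of_logQAvoid_le_szpiro T hP h7 h

/-- **The PURE Szpiro-type antecedent (no additive constant)**: for `λ ∈ U_P` (minimally presented), `l ≥ 7` and every
genuine Θ-volume datum `T` at `(P, l)`, `log(q^{∤{2,l}}(λ)) ≤ (24(d_mod−1)/l)·(log-diff + log-cond)` implies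
`T.HullEstimateOf (B_III P l)` — using only `#{p ∈ T(I) : p ≤ d*·l} ≤ π(d*·l)` (the prime-count slack is `≥ 0`), so the
conductor share alone absorbs the residue. E.g. at `l = 7`, `d_mod = 2`: `log q ≤ (24/7)·(log-diff + log-cond)` suffices.
[cite: Mochizuki2012, IUTchIV Thm. 1.10 proof Steps (ii)–(viii) p. 24–30] [claim: Mochizuki2012, status: disputed] -/
theorem hullEstimateOf_BIII_of_logQAvoid_le_szpiro' (T : Cor22.ThetaVolumeDatumAt P l) (hP : P ∈ UP) (h7 : 7 ≤ l)
    (h : Cor22.logQAvoid P {2, l} ≤ 24 * ((Cor22.dmod P : ℝ) - 1) / l * (P.logDiff + Cor22.logCondAvoid P {2, l})) :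
    T.HullEstimateOf (((l : ℝ) + 1) / 4 * ((1 + 12 * (Cor22.dmod P : ℝ) / l) * (P.logDiff + Cor22.logCondAvoid P {2, l})
      + 2 * Real.log l + 52 + 20 / 3 * Real.log (((2 ^ 12 * 3 ^ 3 * 5 * Cor22.dmod P : ℕ) : ℝ) * (l : ℝ))
        * (Nat.primeCounting (2 ^ 12 * 3 ^ 3 * 5 * Cor22.dmod P * l) : ℝ))) := by
  classical
  letI := T.instFieldF; letI := T.instNumberFieldF; letI := T.instAlgebraF; letI := T.instFieldK
  letI := T.instNumberFieldK; letI := T.instAlgebraK; letI := T.instIsElliptic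
  have hl1 : 1 ≤ l := by omega
  have hd : 1 ≤ Cor22.dmod P := Cor22.dmod_pos P
  have hlmod := log_dstar_mul_nonneg₄ hd hl1
  refine hullEstimateOf_BIII_of_slotResidue_le_szpiroSlack T hP h7 ?_
  have hres := slotResidue_le_logQAvoid T
  have hl0 : (0 : ℝ) ≤ ((l : ℝ) + 1) / 24 := by positivity
  -- the prime-count slack is nonnegative: `#{p ∈ T(I) : p ≤ N} ≤ π(N)` (every support prime is prime)
  have hcnt : (((T.I.supportPrimes.filter (· ≤ 2 ^ 12 * 3 ^ 3 * 5 * Cor22.dmod P * l)).card : ℝ)) ≤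
      (Nat.primeCounting (2 ^ 12 * 3 ^ 3 * 5 * Cor22.dmod P * l) : ℝ) := by
    have hsub : T.I.supportPrimes.filter (· ≤ 2 ^ 12 * 3 ^ 3 * 5 * Cor22.dmod P * l) ⊆
        Nat.primesLE (2 ^ 12 * 3 ^ 3 * 5 * Cor22.dmod P * l) := by
      intro p hp
      rw [Finset.mem_filter] at hp
      rw [Nat.mem_primesLE]
      exact ⟨hp.2, T.I.prime_of_mem_supportPrimes hp.1⟩
    have hc : (T.I.supportPrimes.filter (· ≤ 2 ^ 12 * 3 ^ 3 * 5 * Cor22.dmod P * l)).card ≤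
        Nat.primeCounting (2 ^ 12 * 3 ^ 3 * 5 * Cor22.dmod P * l) := by
      rw [← Nat.primesLE_card_eq_primeCounting]; exact Finset.card_le_card hsub
    exact_mod_cast hc
  have h1 := mul_le_mul_of_nonneg_left h hl0
  have h2 : 0 ≤ Real.log (((2 ^ 12 * 3 ^ 3 * 5 * Cor22.dmod P : ℕ) : ℝ) * l) *
      ((Nat.primeCounting (2 ^ 12 * 3 ^ 3 * 5 * Cor22.dmod P * l) : ℝ)
        - ((T.I.supportPrimes.filter (· ≤ 2 ^ 12 * 3 ^ 3 * 5 * Cor22.dmod P * l)).card : ℝ)) :=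
    mul_nonneg hlmod (by linarith)
  have e1 : ((l : ℝ) + 1) / 24 * (24 * ((Cor22.dmod P : ℝ) - 1) / l * (P.logDiff + Cor22.logCondAvoid P {2, l})) =
      ((l : ℝ) + 1) / 4 * (4 * ((Cor22.dmod P : ℝ) - 1) / l * (P.logDiff + Cor22.logCondAvoid P {2, l})) := by ring
  have hc0 : (0 : ℝ) ≤ ((l : ℝ) + 1) / 4 := by positivity
  have h3 : ((l : ℝ) + 1) / 4 * (4 * ((Cor22.dmod P : ℝ) - 1) / l * (P.logDiff + Cor22.logCondAvoid P {2, l})) ≤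
      ((l : ℝ) + 1) / 4 * (4 * ((Cor22.dmod P : ℝ) - 1) / l * (P.logDiff + Cor22.logCondAvoid P {2, l})
        + 20 / 3 * Real.log (((2 ^ 12 * 3 ^ 3 * 5 * Cor22.dmod P : ℕ) : ℝ) * l)
          * ((Nat.primeCounting (2 ^ 12 * 3 ^ 3 * 5 * Cor22.dmod P * l) : ℝ)
            - ((T.I.supportPrimes.filter (· ≤ 2 ^ 12 * 3 ^ 3 * 5 * Cor22.dmod P * l)).card : ℝ))) := by
    apply mul_le_mul_of_nonneg_left _ hc0
    have h20 : 0 ≤ 20 / 3 * (Real.log (((2 ^ 12 * 3 ^ 3 * 5 * Cor22.dmod P : ℕ) : ℝ) * l) *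
        ((Nat.primeCounting (2 ^ 12 * 3 ^ 3 * 5 * Cor22.dmod P * l) : ℝ)
          - ((T.I.supportPrimes.filter (· ≤ 2 ^ 12 * 3 ^ 3 * 5 * Cor22.dmod P * l)).card : ℝ))) :=
      mul_nonneg (by norm_num) h2
    rw [← mul_assoc] at h20
    linarith
  calc T.I.X.slotResidue T.I.supportPrimes ≤ ((l : ℝ) + 1) / 24 * Cor22.logQAvoid P {2, l} := hres
    _ ≤ ((l : ℝ) + 1) / 24 * (24 * ((Cor22.dmod P : ℝ) - 1) / l * (P.logDiff + Cor22.logCondAvoid P {2, l})) := h1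
    _ = ((l : ℝ) + 1) / 4 * (4 * ((Cor22.dmod P : ℝ) - 1) / l * (P.logDiff + Cor22.logCondAvoid P {2, l})) := e1
    _ ≤ _ := h3

/-- **The `∀ T` form of the pure Szpiro-type antecedent: `Cor22.HullVolumeAtDatum P l (B_III P l)` at every `(P, l)` with
`λ ∈ U_P` (minimally presented), `l ≥ 7` and `log(q^{∤{2,l}}(λ)) ≤ (24(d_mod−1)/l)·(log-diff + log-cond)`.** DATUM-FREE, IUT-free
antecedent; no additive constant. [cite: Mochizuki2012, IUTchIV Thm. 1.10 proof Steps (ii)–(viii) p. 24–30]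
[claim: Mochizuki2012, status: disputed] -/
theorem hullVolumeAtDatum_BIII_of_logQAvoid_le_szpiro' (hP : P ∈ UP) (h7 : 7 ≤ l)
    (h : Cor22.logQAvoid P {2, l} ≤ 24 * ((Cor22.dmod P : ℝ) - 1) / l * (P.logDiff + Cor22.logCondAvoid P {2, l})) :
    Cor22.HullVolumeAtDatum P l (((l : ℝ) + 1) / 4 * ((1 + 12 * (Cor22.dmod P : ℝ) / l)
      * (P.logDiff + Cor22.logCondAvoid P {2, l}) + 2 * Real.log l + 52
        + 20 / 3 * Real.log (((2 ^ 12 * 3 ^ 3 * 5 * Cor22.dmod P : ℕ) : ℝ) * (l : ℝ))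
          * (Nat.primeCounting (2 ^ 12 * 3 ^ 3 * 5 * Cor22.dmod P * l) : ℝ))) :=
  fun T => hullEstimateOf_BIII_of_logQAvoid_le_szpiro' T hP h7 h

end PointDict

end Summit.ABC.IUTFork

end
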